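import Summits.CriticalPhenomena.PercolationContinuityZ3.Theorems.Transplant.FKConnectivityAllQPat3ShapeTwo
import Summits.CriticalPhenomena.PercolationContinuityZ3.Theorems.Transplant.FKConnectivityAllQPat3FamP11
import Summits.CriticalPhenomena.PercolationContinuityZ3.Theorems.Transplant.FKConnectivityAllQPat3GenDict
import HarnessLib

/-!
# Connectivity correlation inequalities for `φ_{w,q}`, every `q > 0` — TWO-PIECE SHAPES: generator pools by index, orbit cells, and
# the TABULATED certificate check (side table → coefficient table → rows, each a cheap kernel computation; census g40)

Definitions + theorems file (`--supports stmt-CriticalPhenomena-4575`), census lineage (gen 40) of LANE 2's FK sub-programme; builds on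
p205010 (kernel theorem, internal audit signed; external expert review pending).  No named facts, no sorries; standard axioms.

* `FK.Prod2.ofIdx fam (λ, shift, i₁, i₂)` (generators `famGet fam i₁/i₂`) and `FK.Prod2.ofIdx_nonneg`;
* census g36's `FK.orbTab P Q` (`…Pat3GenDict.lean`) = census g39's LP cells `orb_P_Q` (the indicator of the unordered pattern pair at
  level 0 — ENTRYWISE nonnegative, hence a legitimate generator on every piece: `FK.lev2C_nonneg_of_entry_nonneg`), `FK.orbFam` (15 cells, order `P ≤ Q` of
  `Pat3.list²`), **`FK.famP11orb = famP11 ++ orbFam`** (indices `11 … 25` = cells) and `FK.famGet_famP11orb_nonneg`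
  (levelwise nonnegativity of `famP11` on a minor extends to the pool);
* the tabulated check: `FK.Pat3.ix`, `FK.maskOf`, `FK.allBits` (+ `mem_allBits`), `FK.sumBits_congr_len`, `FK.side2R`, `FK.sideGet2`,
  **`FK.sideCheck2`** (+ `_spec`: a side literal `[mask][P1][P2] ↦ (pattern, corrections)` IS `FK.side2` read at the marks),
  `FK.coefSide2`, `FK.coefTab2_eq_coefSide2`, `FK.coefGet2`, **`FK.coefCheck2`** (+ `_spec`: a coefficient literal
  `[d][P1][Q1][P2][Q2]` IS `FK.coefTab2` for `d < nd`), `FK.Prod2.tensorK` (+ `_eq`), `FK.certRows2T`, **`FK.certCheck2T`**,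
  `FK.certCheck2T_of_levels` (one kernel computation per level), and **`FK.rows_of_tab2`**: the three passed checks (with
  `2|L| + 2 ≤ B`) give the rowwise domination consumed by `FK.shape2C_nonneg_of_rows`.
WHY TABULATE: the direct `FK.certCheck2S` re-folds the skeleton inside every one of the `25² · (B + 4)` rows and exhausts kernel memory
already on VEE\* (4 plain edges, 33 products); the tabulated form evaluates `FK.side2` once per (colouring, pattern pair).
[cite: AyyerLinussonRavichandran2025, §7 (p. 22)]
-/

namespace Summit.CriticalPhenomena.PercolationContinuityZ3.Theorems

namespace FK

open SimpleGraph Literature.Probability.LatticeModels Literature.Probability.Percolation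
open scoped Classical

variable {V : Type*}
section ProdIdx

/-- A two-piece product given by family indices `(λ, shift, i₁, i₂)`: generators `famGet fam i₁`, `famGet fam i₂`. [folklore] -/
def Prod2.ofIdx (fam : List (ℕ → Pat3 → Pat3 → ℤ)) (c : ℕ × ℕ × ℕ × ℕ) : Prod2 :=
  ⟨c.1, c.2.1, famGet fam c.2.2.1, famGet fam c.2.2.2⟩

/-- Index-given products inherit levelwise nonnegativity from the family on each piece. [folklore] -/
theorem Prod2.ofIdx_nonneg {fam : List (ℕ → Pat3 → Pat3 → ℤ)} {cs : List (ℕ × ℕ × ℕ × ℕ)}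
    {E₁ C₁ E₂ C₂ : Finset (Sym2 V)} {u₁ v₁ m₁ u₂ v₂ m₂ : V}
    (h1 : ∀ i ν, 0 ≤ lev2C E₁ C₁ u₁ v₁ m₁ (famGet fam i) ν) (h2 : ∀ i ν, 0 ≤ lev2C E₂ C₂ u₂ v₂ m₂ (famGet fam i) ν) :
    ∀ q ∈ cs.map (Prod2.ofIdx fam), ∀ ν : ℕ, 0 ≤ lev2C E₁ C₁ u₁ v₁ m₁ q.g1 ν ∧ 0 ≤ lev2C E₂ C₂ u₂ v₂ m₂ q.g2 ν := by
  intro q hq ν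
  rw [List.mem_map] at hq
  obtain ⟨c, _, rfl⟩ := hq
  exact ⟨h1 _ ν, h2 _ ν⟩

end ProdIdx

section Orbit

variable [Fintype V]

/- `FK.orbTab P Q` (census g36's `…Pat3GenDict.lean`): the orbit-indicator table of the unordered pattern pair `{P, Q}` at level
`c = 0` = census g39's LP cells `orb_P_Q` — ENTRYWISE nonnegative, hence levelwise nonnegative on EVERY piece. -/

/-- The fifteen orbit-indicator tables, in the order `P ≤ Q` of `Pat3.list × Pat3.list`. [folklore] -/
def orbFam : List (ℕ → Pat3 → Pat3 → ℤ) :=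
  [orbTab Pat3.all Pat3.all, orbTab Pat3.all Pat3.xy_s, orbTab Pat3.all Pat3.xs_y, orbTab Pat3.all Pat3.ys_x,
    orbTab Pat3.all Pat3.sep, orbTab Pat3.xy_s Pat3.xy_s, orbTab Pat3.xy_s Pat3.xs_y, orbTab Pat3.xy_s Pat3.ys_x,
    orbTab Pat3.xy_s Pat3.sep, orbTab Pat3.xs_y Pat3.xs_y, orbTab Pat3.xs_y Pat3.ys_x, orbTab Pat3.xs_y Pat3.sep,
    orbTab Pat3.ys_x Pat3.ys_x, orbTab Pat3.ys_x Pat3.sep, orbTab Pat3.sep Pat3.sep]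

/-- `famP11` extended by the orbit cells (the generator pool of census g39's two-piece LPs; indices `11 … 25`). [folklore] -/
def famP11orb : List (ℕ → Pat3 → Pat3 → ℤ) := famP11 ++ orbFam

omit [Fintype V] in
/-- An entrywise nonnegative table is levelwise nonnegative on every contracted minor. [folklore] -/
theorem lev2C_nonneg_of_entry_nonneg (E C : Finset (Sym2 V)) (x y s : V) {F : ℕ → Pat3 → Pat3 → ℤ}
    (hF : ∀ c A B, 0 ≤ F c A B) (μ : ℕ) : 0 ≤ lev2C E C x y s F μ := by
  unfold lev2C
  refine Finset.sum_nonneg fun γ _ => add_nonneg ?_ ?_ <;> split_ifs <;> first | exact hF _ _ _ | exact le_rfl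

omit [Fintype V] in
/-- Orbit cells are entrywise nonnegative. [folklore] -/
theorem orbTab_nonneg (P Q : Pat3) (c : ℕ) (A B : Pat3) : 0 ≤ orbTab P Q c A B := by
  unfold orbTab
  split_ifs <;> decide

omit [Fintype V] in
/-- Every member of `orbFam` (and the zero table beyond it) is levelwise nonnegative on every contracted minor. [folklore] -/
theorem famGet_orbFam_nonneg (E C : Finset (Sym2 V)) (x y s : V) (i μ : ℕ) : 0 ≤ lev2C E C x y s (famGet orbFam i) μ := by
  refine lev2C_nonneg_of_entry_nonneg E C x y s (fun c A B => ?_) μ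
  unfold famGet orbFam
  simp only [List.getD_eq_getElem?_getD]
  by_cases hi : i < 15
  · interval_cases i <;> exact orbTab_nonneg _ _ c A B
  · rw [List.getElem?_eq_none (by simp only [List.length_cons, List.length_nil]; omega), Option.getD_none]

omit [Fintype V] in
/-- Levelwise nonnegativity of `famP11` on a minor extends to `famP11orb`. [folklore] -/
theorem famGet_famP11orb_nonneg {E C : Finset (Sym2 V)} {x y s : V}
    (h : ∀ i ν, 0 ≤ lev2C E C x y s (famGet famP11 i) ν) (i ν : ℕ) : 0 ≤ lev2C E C x y s (famGet famP11orb i) ν := by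
  unfold famP11orb
  by_cases hi : i < famP11.length
  · have e : famGet (famP11 ++ orbFam) i = famGet famP11 i := by
      unfold famGet
      simp only [List.getD_eq_getElem?_getD, List.getElem?_append_left hi]
    rw [e]; exact h i ν
  · rw [not_lt] at hi
    have e : famGet (famP11 ++ orbFam) i = famGet orbFam (i - famP11.length) := by
      unfold famGet
      simp only [List.getD_eq_getElem?_getD, List.getElem?_append_right hi]
    rw [e]; exact famGet_orbFam_nonneg E C x y s _ ν

end Orbit

/-! ### Tabulated certificate checking for two-piece shapes (side table → coefficient table → rows), kernel-cheap -/

section TabTwo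

variable {ι : Type*} [DecidableEq ι]

/-- The position of a pattern in `Pat3.list`. [folklore] -/
def Pat3.ix : Pat3 → ℕ
  | .all => 0
  | .xy_s => 1
  | .xs_y => 2
  | .ys_x => 3
  | .sep => 4

/-- The little-endian mask of a bit list (first bit = lowest). [folklore] -/
def maskOf : List Bool → ℕ
  | [] => 0
  | b :: bs => (if b then 1 else 0) + 2 * maskOf bs

/-- All bit lists of length `n`, in the order of `FK.sumBits`. [folklore] -/
def allBits : ℕ → List (List Bool)
  | 0 => [[]]
  | n + 1 => (allBits n).map (false :: ·) ++ (allBits n).map (true :: ·)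

/-- `allBits n` is exactly the lists of length `n`. [folklore] -/
theorem mem_allBits {n : ℕ} {bs : List Bool} : bs ∈ allBits n ↔ bs.length = n := by
  induction n generalizing bs with
  | zero => cases bs <;> simp [allBits]
  | succ n ih =>
    cases bs with
    | nil => simp [allBits]
    | cons b bs => cases b <;> simp [allBits, ih]

/-- `sumBits n` only sees lists of length `n`. [folklore] -/
theorem sumBits_congr_len (n : ℕ) {f g : List Bool → ℤ} (h : ∀ bs, bs.length = n → f bs = g bs) : sumBits n f = sumBits n g := by
  induction n generalizing f g with
  | zero => exact h [] rfl
  | succ n ih =>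
    show sumBits n (fun bs => f (false :: bs)) + sumBits n (fun bs => f (true :: bs)) =
      sumBits n (fun bs => g (false :: bs)) + sumBits n (fun bs => g (true :: bs))
    rw [ih fun bs hbs => h (false :: bs) (by rw [List.length_cons, hbs]),
      ih fun bs hbs => h (true :: bs) (by rw [List.length_cons, hbs])]

/-- The reading of one side of a two-piece shape: (pattern at the marks, level corrections). [folklore] -/
def side2R (L : List (ι × ι)) (i1 j1 k1 i2 j2 k2 ix iy is : ι) (bs : List Bool) (P1 P2 : Pat3) : Pat3 × ℕ :=
  (rdPat ix iy is (side2 L i1 j1 k1 i2 j2 k2 bs P1 P2).1, (side2 L i1 j1 k1 i2 j2 k2 bs P1 P2).2)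

/-- Lookup in a side table `[mask][P1][P2]`. [folklore] -/
def sideGet2 (S : List (List (List (Pat3 × ℕ)))) (bs : List Bool) (P1 P2 : Pat3) : Pat3 × ℕ :=
  ((S.getD (maskOf bs) []).getD P1.ix []).getD P2.ix (Pat3.all, 0)

/-- **Side-table check**: the literal `S` IS the side reading of the shape on every colouring and pattern pair. [folklore] -/
def sideCheck2 (L : List (ι × ι)) (i1 j1 k1 i2 j2 k2 ix iy is : ι) (S : List (List (List (Pat3 × ℕ)))) : Bool :=
  (allBits L.length).all fun bs => Pat3.list.all fun P1 => Pat3.list.all fun P2 =>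
    decide (sideGet2 S bs P1 P2 = side2R L i1 j1 k1 i2 j2 k2 ix iy is bs P1 P2)

/-- Unpacking a passed side-table check. [folklore] -/
theorem sideCheck2_spec {L : List (ι × ι)} {i1 j1 k1 i2 j2 k2 ix iy is : ι} {S : List (List (List (Pat3 × ℕ)))}
    (h : sideCheck2 L i1 j1 k1 i2 j2 k2 ix iy is S = true) {bs : List Bool} (hbs : bs.length = L.length) (P1 P2 : Pat3) :
    sideGet2 S bs P1 P2 = side2R L i1 j1 k1 i2 j2 k2 ix iy is bs P1 P2 := by
  unfold sideCheck2 at h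
  simp only [List.all_eq_true, decide_eq_true_eq] at h
  exact h bs (mem_allBits.2 hbs) P1 P1.mem_list P2 P2.mem_list

/-- The coefficient table computed from a side table (same body as `FK.coefTab2`, lookups instead of folds). [folklore] -/
def coefSide2 (n : ℕ) (S : List (List (List (Pat3 × ℕ)))) (F : ℕ → Pat3 → Pat3 → ℤ) (d : ℕ) (P1 Q1 P2 Q2 : Pat3) : ℤ :=
  sumBits n fun bs =>
    (if (sideGet2 S bs P1 P2).2 + (sideGet2 S (bs.map (! ·)) Q1 Q2).2 = d then
        F 0 (sideGet2 S bs P1 P2).1 (sideGet2 S (bs.map (! ·)) Q1 Q2).1 else 0) +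
      (if (sideGet2 S bs P1 P2).2 + (sideGet2 S (bs.map (! ·)) Q1 Q2).2 + 1 = d then
        F 1 (sideGet2 S bs P1 P2).1 (sideGet2 S (bs.map (! ·)) Q1 Q2).1 else 0)

/-- With a correct side table, `FK.coefSide2` IS `FK.coefTab2`. [folklore] -/
theorem coefTab2_eq_coefSide2 {L : List (ι × ι)} {i1 j1 k1 i2 j2 k2 ix iy is : ι} {S : List (List (List (Pat3 × ℕ)))}
    (h : sideCheck2 L i1 j1 k1 i2 j2 k2 ix iy is S = true) (F : ℕ → Pat3 → Pat3 → ℤ) (d : ℕ) (P1 Q1 P2 Q2 : Pat3) :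
    coefTab2 L i1 j1 k1 i2 j2 k2 ix iy is F d P1 Q1 P2 Q2 = coefSide2 L.length S F d P1 Q1 P2 Q2 := by
  unfold coefTab2 coefSide2
  refine sumBits_congr_len L.length fun bs hbs => ?_
  have hbs' : (bs.map (! ·)).length = L.length := by rw [List.length_map, hbs]
  have e1 := sideCheck2_spec h hbs P1 P2
  have e2 := sideCheck2_spec h hbs' Q1 Q2
  unfold side2R at e1 e2
  rw [e1, e2]

/-- Lookup in a coefficient literal `[d][P1][Q1][P2][Q2]`. [folklore] -/
def coefGet2 (T : List (List (List (List (List ℤ))))) (d : ℕ) (P1 Q1 P2 Q2 : Pat3) : ℤ :=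
  ((((T.getD d []).getD P1.ix []).getD Q1.ix []).getD P2.ix []).getD Q2.ix 0

/-- **Coefficient-table check**: the literal `T` IS the coefficient table (from the side table) at all levels `d < nd`. [folklore] -/
def coefCheck2 (n : ℕ) (S : List (List (List (Pat3 × ℕ)))) (F : ℕ → Pat3 → Pat3 → ℤ) (T : List (List (List (List (List ℤ)))))
    (nd : ℕ) : Bool :=
  (List.range nd).all fun d => Pat3.list.all fun P1 => Pat3.list.all fun Q1 => Pat3.list.all fun P2 => Pat3.list.all fun Q2 =>
    decide (coefGet2 T d P1 Q1 P2 Q2 = coefSide2 n S F d P1 Q1 P2 Q2)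

/-- Unpacking a passed coefficient-table check. [folklore] -/
theorem coefCheck2_spec {n : ℕ} {S : List (List (List (Pat3 × ℕ)))} {F : ℕ → Pat3 → Pat3 → ℤ}
    {T : List (List (List (List (List ℤ))))} {nd : ℕ} (h : coefCheck2 n S F T nd = true) {d : ℕ} (hd : d < nd)
    (P1 Q1 P2 Q2 : Pat3) : coefGet2 T d P1 Q1 P2 Q2 = coefSide2 n S F d P1 Q1 P2 Q2 := by
  unfold coefCheck2 at h
  simp only [List.all_eq_true, decide_eq_true_eq] at h
  exact h d (List.mem_range.2 hd) P1 P1.mem_list Q1 Q1.mem_list P2 P2.mem_list Q2 Q2.mem_list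

/-- The tensor of a two-piece product, spelled out (kernel-cheap form of `FK.Prod2.tensor`). [folklore] -/
def Prod2.tensorK (p : Prod2) (d : ℕ) (P1 Q1 P2 Q2 : Pat3) : ℤ :=
  (if p.shift = d then p.g1 0 P1 Q1 * p.g2 0 P2 Q2 else 0) +
    (if p.shift + 1 = d then p.g1 0 P1 Q1 * p.g2 1 P2 Q2 + p.g1 1 P1 Q1 * p.g2 0 P2 Q2 else 0) +
    (if p.shift + 2 = d then p.g1 1 P1 Q1 * p.g2 1 P2 Q2 else 0)

/-- The spelled-out tensor is the tensor. [folklore] -/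
theorem Prod2.tensorK_eq (p : Prod2) (d : ℕ) (P1 Q1 P2 Q2 : Pat3) : p.tensorK d P1 Q1 P2 Q2 = p.tensor d P1 Q1 P2 Q2 := by
  unfold Prod2.tensorK Prod2.tensor
  simp only [Finset.sum_range_succ, Finset.sum_range_zero, zero_add, add_zero, Nat.reduceAdd]
  split_ifs <;> first | (exfalso; omega) | ring

/-- The rows of the tabulated certificate check at one residual level `d`. [folklore] -/
def certRows2T (T : List (List (List (List (List ℤ))))) (prods : List Prod2) (Dn d : ℕ) : Bool :=
  Pat3.list.all fun P1 => Pat3.list.all fun Q1 => Pat3.list.all fun P2 => Pat3.list.all fun Q2 =>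
    decide (4 * (prods.map fun q => (q.lam : ℤ) * q.tensorK d P1 Q1 P2 Q2).sum ≤ (Dn : ℤ) * symm4d (coefGet2 T) d P1 Q1 P2 Q2)

/-- **THE TABULATED CERTIFICATE CHECK of a two-piece shape**: `FK.certCheck2S` with the coefficient literal in place of the fold,
level by level. [folklore] -/
def certCheck2T (T : List (List (List (List (List ℤ))))) (prods : List Prod2) (Dn B : ℕ) : Bool :=
  (prods.all fun q => decide (q.shift ≤ B)) && (List.range (B + 4)).all (certRows2T T prods Dn)

/-- Assembling the tabulated check from its levels (each level is its own kernel computation). [folklore] -/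
theorem certCheck2T_of_levels {T : List (List (List (List (List ℤ))))} {prods : List Prod2} {Dn B : ℕ}
    (hs : (prods.all fun q => decide (q.shift ≤ B)) = true) (h : ∀ d, d < B + 4 → certRows2T T prods Dn d = true) :
    certCheck2T T prods Dn B = true := by
  unfold certCheck2T
  rw [hs, Bool.true_and, List.all_eq_true]
  exact fun d hd => h d (List.mem_range.1 hd)

/-- **Rows from the three tabulated checks** (side table, coefficient table up to `B + 4`, rows): the rowwise domination that
`FK.shape2C_nonneg_of_rows` consumes. [folklore] -/
theorem rows_of_tab2 {L : List (ι × ι)} {i1 j1 k1 i2 j2 k2 ix iy is : ι} {F : ℕ → Pat3 → Pat3 → ℤ}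
    {S : List (List (List (Pat3 × ℕ)))} {T : List (List (List (List (List ℤ))))} {prods : List Prod2} {Dn B : ℕ}
    (hB : 2 * L.length + 2 ≤ B) (hS : sideCheck2 L i1 j1 k1 i2 j2 k2 ix iy is S = true)
    (hT : coefCheck2 L.length S F T (B + 4) = true) (hc : certCheck2T T prods Dn B = true) (d : ℕ) (P1 Q1 P2 Q2 : Pat3) :
    4 * (prods.map fun q => (q.lam : ℤ) * q.tensor d P1 Q1 P2 Q2).sum ≤
      (Dn : ℤ) * symm4d (coefTab2 L i1 j1 k1 i2 j2 k2 ix iy is F) d P1 Q1 P2 Q2 := by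
  unfold certCheck2T certRows2T at hc
  rw [Bool.and_eq_true] at hc
  obtain ⟨hshift, hmain⟩ := hc
  simp only [List.all_eq_true, decide_eq_true_eq, Prod2.tensorK_eq] at hshift hmain
  by_cases hd : d < B + 4
  · have e : ∀ A1 A2 A3 A4 : Pat3, coefTab2 L i1 j1 k1 i2 j2 k2 ix iy is F d A1 A2 A3 A4 = coefGet2 T d A1 A2 A3 A4 :=
      fun A1 A2 A3 A4 => by rw [coefTab2_eq_coefSide2 hS, coefCheck2_spec hT hd]
    simp only [symm4d, e]
    exact hmain d (List.mem_range.2 hd) P1 P1.mem_list Q1 Q1.mem_list P2 P2.mem_list Q2 Q2.mem_list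
  · rw [not_lt] at hd
    have hz : ∀ A1 A2 A3 A4 : Pat3, coefTab2 L i1 j1 k1 i2 j2 k2 ix iy is F d A1 A2 A3 A4 = 0 :=
      fun _ _ _ _ => coefTab2_eq_zero L i1 j1 k1 i2 j2 k2 ix iy is F (by omega) _ _ _ _
    simp only [symm4d, hz, add_zero, mul_zero]
    refine le_of_eq ?_
    rw [List.sum_eq_zero fun x hx => ?_, mul_zero]
    rw [List.mem_map] at hx
    obtain ⟨q, hq, rfl⟩ := hx
    rw [Prod2.tensor_eq_zero_of_le q (hshift q hq) hd, mul_zero]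

end TabTwo

end FK

end Summit.CriticalPhenomena.PercolationContinuityZ3.Theorems
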